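import Summits.BirchSwinnertonDyer.Rank1Residual.Additive.X3BranchLayerKummerZeta81
import Summits.BirchSwinnertonDyer.Rank1Residual.Additive.X3BranchZeta27CubicResidues
import Summits.BirchSwinnertonDyer.Rank1Residual.Additive.X3BranchLayerTIndependence
import HarnessLib

/-!
# X3, the DEGENERATE rows OFF the sub-locus: INDEPENDENCE of the SECOND-LAYER T-side Kummer characters on
# `G_{ℚ_∞}` (STEP 3 `LayerCharTower.exists_eq_zeta81_pow_mul_aeval` + STEP 4
# `KummerLayerTwisted.eq_zero_of_prod_eq_zeta27_pow_mul_cube`) (cell `bsd-eis`, seat `bsd-eis-x3` gen 8;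
# the file `X3BranchLayerTIndependence.lean` one level up; x3-MEMO-10 §5 (f); route K1
# `AdditiveBranchIMC`, crux `GordTwoRankZeroOffCaseOne` — supports only)

HONEST FRAMING (`run/shared/lean/pub/bsd-eis/README.md` §4): THEOREMS ONLY (no `def`, no named fact,
no `sorry`); nothing is booked; no label, tier or count of record moves.

## What

`κ` cyclotomic, `ζ` a primitive `27`-th root of unity (`ζ₃ = ζ⁹`), radicands `bᵢ = Σ_{k<18} b_{ik} ζ^k`
with cube roots `βᵢ`, characters `χᵢ` with `σβᵢ = ζ₃^{χᵢ σ} βᵢ` for `σ ∈ L₂ ∩ Stab(ζ₃)` (the export of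
`exists_layerTwoTClass_full`), and `d ∈ 𝔽₃^ι` such that `ψ = Σ dᵢ χᵢ` is locally constant, additive on
`L₂` and ZERO ON `ker κ = G_{ℚ_∞}`. With the cubic-residue certificate of
`eq_zero_of_prod_eq_zeta27_pow_mul_cube` (primes `q ≡ 1 (mod 81)`): `d = 0`
(`eq_zero_of_layerTwoT_dependency`). Proof: a primitive `81`-st root `z` with `z³ = ζ`
(`exists_isPrimitiveRoot_eightyone`); `X = ∏ βᵢ^{dᵢ}` has `σX = ζ₃^{ψσ}X` on `L₂ ∩ Stab(ζ₃)`, so STEP 3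
gives `X = z^c G(ζ)`, whence `∏ bᵢ^{dᵢ} = X³ = ζ^c G(ζ)³`, and STEP 4 concludes.
References: [Washington1997] §13.1; [IrelandRosen1990] Ch. 9 §1.
-/

set_option autoImplicit false

noncomputable section

open scoped Classical

namespace Summit.BirchSwinnertonDyer.Rank1Residual.Additive

namespace KummerLayerTwisted

open Field Polynomial Finset
open Literature.NumberTheory.GaloisRepresentations
open Literature.NumberTheory.EllipticCurves

/-- **A primitive `81`-st root of unity above `ζ₂₇`**: a cube root `z` of a primitive `27`-th root of
unity `ζ` is a primitive `81`-st root of unity. [folklore] -/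
theorem exists_isPrimitiveRoot_eightyone {ζ : AlgebraicClosure ℚ} (hζ : IsPrimitiveRoot ζ 27) :
    ∃ z : AlgebraicClosure ℚ, IsPrimitiveRoot z 81 ∧ z ^ 3 = ζ := by
  obtain ⟨z, hz⟩ := IsAlgClosed.exists_pow_nat_eq ζ (by norm_num : 0 < 3)
  refine ⟨z, ?_, hz⟩
  have h81 : z ^ 81 = 1 := by
    rw [show (81 : ℕ) = 3 * 27 by norm_num, pow_mul, hz, hζ.pow_eq_one]
  have hdvd : orderOf z ∣ 3 ^ 4 := orderOf_dvd_of_pow_eq_one (by norm_num; exact h81)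
  obtain ⟨k, hk, hk'⟩ := (Nat.dvd_prime_pow Nat.prime_three).mp hdvd
  have hne : ¬ orderOf z ∣ 27 := by
    intro h27
    have hz27 : z ^ 27 = 1 := orderOf_dvd_iff_pow_eq_one.mp h27
    rw [show (27 : ℕ) = 3 * 9 by norm_num, pow_mul, hz] at hz27
    exact hζ.pow_ne_one_of_pos_of_lt (by norm_num) (by norm_num) hz27
  have hk4 : k = 4 := by
    rcases Nat.lt_or_ge k 4 with h | h
    · exfalso; apply hne; rw [hk', show (27 : ℕ) = 3 ^ 3 by norm_num]
      exact Nat.pow_dvd_pow 3 (by omega)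
    · omega
  rw [hk4] at hk'
  have h := IsPrimitiveRoot.orderOf z
  rw [hk'] at h
  norm_num at h
  exact h

/-- **INDEPENDENCE of the second-layer T-side characters.** See the module docstring.
[cite: Washington1997, §13.1] [cite: SerreLocalFields1979, Ch. X §3]
[cite: IrelandRosen1990, Ch. 9 §1 (cubic residue character)] -/
theorem eq_zero_of_layerTwoT_dependency {κ : ZpExtension ℚ 3} (hκ : κ.IsCyclotomic)
    {ζ : AlgebraicClosure ℚ} (hζ : IsPrimitiveRoot ζ 27) {ι : Type} [Fintype ι] [DecidableEq ι]
    (b : ι → Fin 18 → ℤ) (β : ι → AlgebraicClosure ℚ)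
    (hβ : ∀ i, β i ^ 3 = ∑ k : Fin 18, (b i k : AlgebraicClosure ℚ) * ζ ^ (k : ℕ))
    (χ : ι → absoluteGaloisGroup ℚ → ZMod 3)
    (hχ : ∀ i, ∀ σ ∈ κ.layerSubgroup 2, σ • ζ ^ 9 = ζ ^ 9 →
      ∃ m : ℕ, σ • β i = (ζ ^ 9) ^ m * β i ∧ χ i σ = m)
    (d : ι → ZMod 3)
    (hlc : IsLocallyConstant (fun g ↦ ∑ i, d i * χ i g))
    (hadd : ∀ a ∈ κ.layerSubgroup 2, ∀ a' ∈ κ.layerSubgroup 2,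
      (∑ i, d i * χ i (a * a')) = (∑ i, d i * χ i a) + ∑ i, d i * χ i a')
    (hker : ∀ h ∈ κ.kerSubgroup, (∑ i, d i * χ i h) = 0)
    {R : ℕ} (q : Fin R → ℕ) (hq : ∀ ρ, (q ρ).Prime) (hq81 : ∀ ρ, 81 ∣ q ρ - 1)
    (r : (ρ : Fin R) → Fin 18 → ZMod (q ρ)) (hr : ∀ ρ k, r ρ k ^ 18 + r ρ k ^ 9 + 1 = 0)
    (w : (ρ : Fin R) → Fin 18 → Fin 18 → ZMod (q ρ))
    (hw : ∀ ρ (a a' : Fin 18), ∑ k, w ρ a k * r ρ k ^ a'.val = if a = a' then 1 else 0)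
    (ω : (ρ : Fin R) → ZMod (q ρ)) (hω : ∀ ρ, ω ρ ^ 3 = 1 ∧ ω ρ ≠ 1)
    (e : Fin R → ι → ℕ)
    (he : ∀ ρ i, (∑ k : Fin 18, (b i k : ZMod (q ρ)) * r ρ 0 ^ (k : ℕ)) ^ ((q ρ - 1) / 3) =
      ω ρ ^ e ρ i)
    (hnz : ∀ ρ i, (∑ k : Fin 18, (b i k : ZMod (q ρ)) * r ρ 0 ^ (k : ℕ)) ≠ 0)
    (L : ι → Fin R → ℤ)
    (hL : ∀ i i', (∑ ρ, (L i ρ : ZMod 3) * (e ρ i' : ZMod 3)) = if i = i' then 1 else 0) :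
    d = 0 := by
  -- a primitive `81`-st root of unity `z` with `z³ = ζ`
  obtain ⟨z, hz, hz3⟩ := exists_isPrimitiveRoot_eightyone hζ
  have hz27 : z ^ 27 = ζ ^ 9 := by rw [show (27 : ℕ) = 3 * 9 by norm_num, pow_mul, hz3]
  have hζ3 : IsPrimitiveRoot (ζ ^ 9) 3 := hζ.pow (by norm_num) (by norm_num)
  set ψ : absoluteGaloisGroup ℚ → ZMod 3 := fun g ↦ ∑ i, d i * χ i g with hψ
  set X : AlgebraicClosure ℚ := ∏ i, β i ^ (d i).val with hX
  have hXσ : ∀ σ ∈ κ.layerSubgroup 2, σ • z ^ 27 = z ^ 27 →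
      σ • X = (z ^ 27) ^ (ψ σ).val * X := by
    intro σ hσ h27
    rw [hz27] at h27 ⊢
    choose mf hmf using fun i ↦ hχ i σ hσ h27
    have h1 : σ • X = ∏ i, ((ζ ^ 9) ^ mf i * β i) ^ (d i).val := by
      rw [hX, smul_prod']
      exact Finset.prod_congr rfl fun i _ ↦ by rw [smul_pow', (hmf i).1]
    have h2 : (∏ i, ((ζ ^ 9) ^ mf i * β i) ^ (d i).val) =
        (ζ ^ 9) ^ (∑ i, mf i * (d i).val) * X := by
      rw [hX, ← Finset.prod_pow_eq_pow_sum, ← Finset.prod_mul_distrib]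
      exact Finset.prod_congr rfl fun i _ ↦ by rw [mul_pow, ← pow_mul]
    have h3 : (((ψ σ).val : ℕ) : ZMod 3) = ((∑ i, mf i * (d i).val : ℕ) : ZMod 3) := by
      rw [ZMod.natCast_zmod_val, hψ]
      push_cast
      refine Finset.sum_congr rfl fun i _ ↦ ?_
      rw [(hmf i).2, ZMod.natCast_zmod_val, mul_comm]
    rw [h1, h2, LayerCharTower.pow_eq_pow_of_natCast_eq hζ3 h3]
  -- STEP 3: `X = z^c · G(ζ)`
  obtain ⟨c, G, hXG⟩ := LayerCharTower.exists_eq_zeta81_pow_mul_aeval hκ hz hlc hadd hker hXσ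
  rw [hz3] at hXG
  -- cube: `∏ bᵢ^{dᵢ} = ζ^c · G(ζ)³`
  have hrel : ∏ i, (∑ k : Fin 18, (b i k : AlgebraicClosure ℚ) * ζ ^ (k : ℕ)) ^ (d i).val =
      ζ ^ c * (aeval ζ G) ^ 3 := by
    have hc : X ^ 3 = ζ ^ c * (aeval ζ G) ^ 3 := by
      rw [hXG, mul_pow, ← pow_mul, mul_comm c 3, pow_mul, hz3]
    rw [← hc, hX, ← Finset.prod_pow]
    exact Finset.prod_congr rfl fun i _ ↦ by rw [← pow_mul, mul_comm, pow_mul, hβ i]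
  -- STEP 4
  exact eq_zero_of_prod_eq_zeta27_pow_mul_cube hζ b hrel q hq hq81 r hr w hw ω hω e he hnz L hL

end KummerLayerTwisted

end Summit.BirchSwinnertonDyer.Rank1Residual.Additive

end
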